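import Summits.BirchSwinnertonDyer.BirchSwinnertonDyer.Theorems.KolyvaginRoadThreeMethod2DefiniteFirstFloorDefs
import Summits.BirchSwinnertonDyer.BirchSwinnertonDyer.Theorems.KolyvaginRoadThreeMethod2StubA
import Summits.BirchSwinnertonDyer.BirchSwinnertonDyer.Theorems.KolyvaginRoadThreeMethod2Eigen
import Literature.NumberTheory.EllipticCurves.HeegnerPointsKolyvaginSelmerProofs
import HarnessLib

/-!
# Route `KolyvaginRoadThree`, crux `ZhangSharpFrameAtThreeHL` (item stmt-BirchSwinnertonDyer-19574), stub S1:
# S1's conclusion AT A FRAME from stub A (LANDED) and the DEFINITE first floor (DLR) + (J′) + (V′)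
# (cell `bsd-stepL`, OWNER seat `bsd-stepL-koly` g16; `--supports stmt-BirchSwinnertonDyer-19574 --as helper`)

W. Zhang's proof of his Thm 7.2 (Camb. J. Math. 2 (2014) pp. 232–233) for `(N⁺, N⁻) = (N, 1)`, transcribed at `p = 3 ∥ N` over the
tree's Brandt-module ∕ Gross-point vocabulary (predicates of `KolyvaginRoadThreeMethod2DefiniteFirstFloorDefs.lean`): at an HL A1 frame
with `dim_𝔽₃ Sel₃(E/K) = 1`, for a conductor-1 Kolyvagin–Heegner datum `d`, IF its class `c(1)` vanished then — `Sel₃ = SelQ ∅⁺ ⊕ SelQ ∅⁻`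
(`finrank_selmer_eq_finrank_selQ_add`) being a line `⟨x⟩ ⊂ SelQ ∅ μ` — stub A (`Method2StubA.stub_levelRaisingAtThree`, koly g13) kills `x`
at a GOOD unipotent-admissible `q` with `SelQ {q} μ = ⊥` and `SelQ {q} ¬μ = SelQ ∅ ¬μ = ⊥`; (DLR) gives a Brandt setup of level `(N, q)`, a
conductor-1 Gross point `x₀` and the mod-3 eigenline `φ`; (V′) makes the Gross period `Σ_σ ⟨σ•x₀, φ⟩` a 3-adic unit; (J′) then makes
`loc_q c(1) ≠ 0`, contradicting `c(1) = 0`. So S1's conclusion `∃ d, d.kolyvaginClass 3 1 ≠ 0` holds at every frame where (DLR), (J′) at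
that `Dt β ι`, and (V′) for a complex conjugation hold at the good u-admissible primes. FRAME-BY-FRAME on purpose: (DLR) with the anemic pin is
expected to hold only where `ρ̄_{E,3}` has conductor exactly `N` (Defs module docstring, THE PIN). NOT A COSTUME: (J′) and (V′) quantify
over the definite objects (`φ`, `x₀`), neither follows from the crux. 0 defs, 0 named facts, 0 `sorry`; CONDITIONAL on its displayed
hypotheses; closes nothing (T7). PARTITION: O2@3 (B10) × A1 × crux 19574 × stub S1 — proves-glue (first floor of S1 over typed objects).

References: [cite: WZhang2014, Thm. 7.2 and its proof, Thm. 2.1, (4.8)–(4.9), Thm. 6.5, Cor. 6.2, Thm. 7.1] [cite: BertoliniDarmon1996, §2]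
[cite: BertoliniDarmon2005, Thm. 9.2].
-/

noncomputable section

open scoped Classical

namespace Summit.BirchSwinnertonDyer.Rank1Residual.X11b.Three.Koly.Method2DefiniteFirstFloor

open WeierstrassCurve NumberField IsDedekindDomain
  Literature.NumberTheory.EllipticCurves Literature.NumberTheory.EllipticCurves.ModularForms
  Literature.NumberTheory.GaloisRepresentations Literature.NumberTheory.Automorphic Module

open Summit.BirchSwinnertonDyer.Rank1Residual.X11b.Three.Koly.Method2

/-- **S1's conclusion at a frame from stub A and the definite first floor.** At an HL A1 frame `(W, K, Dt, β, ι)` with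
`dim_𝔽₃ Sel₃(E/K) = 1`, granting for a complex conjugation `c` (an involution `≠ 1` of `K`) and every GOOD unipotent-admissible `q` the three
definite-side statements (DLR) `DefiniteLevelRaisingAt W K q`, (J′) `JochnowitzAtThree W K Dt β ι q`, (V′) `DefiniteUnitValueAtThree W K c q`,
EVERY conductor-1 Kolyvagin–Heegner datum of the frame has non-zero Kolyvagin class mod 3 (in particular S1's `∃ d, …`, a datum existing
print-free by koly g15's `nonempty_kolyvaginHeegnerData_one_printFree`). W. Zhang's proof of Thm 7.2, with his Lemma 7.3 ∕ Prop 5.4 replaced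
by the LANDED stub A. [cite: WZhang2014, Thm. 7.2 (proof, pp. 232–233)] -/
theorem kolyvaginClass_one_ne_zero_of_definiteFirstFloor
    {W : WeierstrassCurve ℚ} [W.IsElliptic] [W.IsGloballyMinimal] [NeZero (W.conductorNorm ℤ)] {K : Type} [Field K] [NumberField K]
    (Dt : ModularParametrizationData W (W.conductorNorm ℤ)) (β : ℤ) (ι : K →+* ℂ)
    (hX : Summit.BirchSwinnertonDyer.Rank1Residual.ClassX11b W 3) (hmult : W.HasMultiplicativeReductionAtPrime 3)
    (hsurj : Rank1Residual.Surj W 3) (hram : Rank1Residual.Ram W 3) (htam : ¬ 3 ∣ W.tamagawaProduct)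
    (hK : IsImaginaryQuadratic K) (hodd : Odd (NumberField.discr K))
    (hH : SatisfiesHeegnerHypothesis (W.conductorNorm ℤ) K)
    (hLt : (W.quadraticTwist (NumberField.discr K : ℚ)).entireLFunction 1 ≠ 0) (h3 : NumberField.discr K ≠ -3)
    (hβ : (4 * (W.conductorNorm ℤ : ℤ)) ∣ β ^ 2 - NumberField.discr K) (hc : ¬ (3 : ℤ) ∣ Dt.c)
    [Module (ZMod 3) (V3 W K)] (c : K ≃ₐ[ℚ] K) (hc1 : c ≠ 1) (hcc : c * c = 1)
    (hDLR : ∀ q : {q // IsUAdmissiblePrime W K q}, GoodLevel W K {q} → DefiniteLevelRaisingAt W K q)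
    (hJ : ∀ q : {q // IsUAdmissiblePrime W K q}, GoodLevel W K {q} → JochnowitzAtThree W K Dt β ι q)
    (hV : ∀ q : {q // IsUAdmissiblePrime W K q}, GoodLevel W K {q} → DefiniteUnitValueAtThree W K c q)
    (h1 : finrank (ZMod 3) (AddSubgroup.toZModSubmodule 3 (selmerGroup (W.baseChange K) ((3 ^ 1 : ℕ) : ℤ))) = 1)
    (d : KolyvaginHeegnerData Dt β ι 1) : d.kolyvaginClass Nat.prime_three 1 ≠ 0 := by
  intro hzero
  -- the Selmer line and its sign
  rw [finrank_selmer_eq_finrank_selQ_add W K hK c hcc] at h1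
  have hμ : ∃ μ : Bool, finrank (ZMod 3) (SelQ W K c ∅ μ) = 1 ∧ finrank (ZMod 3) (SelQ W K c ∅ (!μ)) = 0 := by
    rcases Nat.eq_zero_or_pos (finrank (ZMod 3) (SelQ W K c ∅ true)) with h0 | hpos
    · exact ⟨false, by omega, h0⟩
    · exact ⟨true, by omega, by change finrank (ZMod 3) (SelQ W K c ∅ false) = 0; omega⟩
  obtain ⟨μ, hμ1, hμ0⟩ := hμ
  have hne : SelQ W K c ∅ μ ≠ ⊥ := by
    intro h
    rw [h, finrank_bot] at hμ1
    exact zero_ne_one hμ1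
  obtain ⟨x, hx, hx0⟩ := Submodule.exists_mem_ne_zero_of_ne_bot hne
  -- stub A (LANDED) at the empty level kills `x` at a good unipotent-admissible prime `q`
  obtain ⟨q, -, hgood, -, -, hrank, hother⟩ :=
    Method2StubA.stub_levelRaisingAtThree W K Dt β ι hX hmult hsurj hram htam hK hodd hH hLt h3 hβ hc c hc1 ∅ μ x
      (goodLevel_empty W K) hx hx0
  rw [Finset.insert_empty] at hgood hrank hother
  haveI := finiteDimensional_selQ W K c ({q} : Finset _) μ
  haveI := finiteDimensional_selQ W K c ({q} : Finset _) (!μ)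
  have hq1 : SelQ W K c {q} μ = ⊥ := Submodule.finrank_eq_zero.mp (by omega)
  have hq2 : SelQ W K c {q} (!μ) = ⊥ := Submodule.finrank_eq_zero.mp (by rw [hother]; exact hμ0)
  -- the definite first floor at `q`
  obtain ⟨S, instF, x₀, φ, hx₀, hφ⟩ := hDLR q hgood
  obtain ⟨v, hv⟩ : ∃ v : HeightOneSpectrum (𝓞 K), ((q : ℕ) : 𝓞 K) ∈ v.asIdeal := by
    have hq3 : (Ideal.span {((q : ℕ) : 𝓞 K)}).IsPrime := q.2.2.2.2.2.1
    refine ⟨⟨Ideal.span {((q : ℕ) : 𝓞 K)}, hq3, ?_⟩, Ideal.mem_span_singleton_self _⟩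
    rw [Ne, Ideal.span_singleton_eq_bot]
    exact_mod_cast q.2.1.ne_zero
  have hVq : ¬ (3 : ℤ) ∣ grossPeriod K S φ x₀ := by
    cases μ
    · exact hV q hgood S x₀ φ hx₀ hφ hq2 hq1
    · exact hV q hgood S x₀ φ hx₀ hφ hq1 hq2
  exact hVq ((hJ q hgood S x₀ φ hx₀ hφ d v hv).mp (by rw [hzero]; exact zero_mem _))

/-- **Corollary in S1's shape at a frame**: under the same hypotheses, `∃ d : KolyvaginHeegnerData Dt β ι 1, d.kolyvaginClass 3 1 ≠ 0`
(the conductor-1 datum exists by CM theory — fed here as the hypothesis `hd`, available print-free as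
`Theorems.nonempty_kolyvaginHeegnerData_one_printFree`, koly g15 p513759). [cite: WZhang2014, Thm. 7.2] -/
theorem bottomRankOne_at_frame_of_definiteFirstFloor
    {W : WeierstrassCurve ℚ} [W.IsElliptic] [W.IsGloballyMinimal] [NeZero (W.conductorNorm ℤ)] {K : Type} [Field K] [NumberField K]
    (Dt : ModularParametrizationData W (W.conductorNorm ℤ)) (β : ℤ) (ι : K →+* ℂ)
    (hX : Summit.BirchSwinnertonDyer.Rank1Residual.ClassX11b W 3) (hmult : W.HasMultiplicativeReductionAtPrime 3)
    (hsurj : Rank1Residual.Surj W 3) (hram : Rank1Residual.Ram W 3) (htam : ¬ 3 ∣ W.tamagawaProduct)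
    (hK : IsImaginaryQuadratic K) (hodd : Odd (NumberField.discr K))
    (hH : SatisfiesHeegnerHypothesis (W.conductorNorm ℤ) K)
    (hLt : (W.quadraticTwist (NumberField.discr K : ℚ)).entireLFunction 1 ≠ 0) (h3 : NumberField.discr K ≠ -3)
    (hβ : (4 * (W.conductorNorm ℤ : ℤ)) ∣ β ^ 2 - NumberField.discr K) (hc : ¬ (3 : ℤ) ∣ Dt.c)
    [Module (ZMod 3) (V3 W K)] (c : K ≃ₐ[ℚ] K) (hc1 : c ≠ 1) (hcc : c * c = 1)
    (hDLR : ∀ q : {q // IsUAdmissiblePrime W K q}, GoodLevel W K {q} → DefiniteLevelRaisingAt W K q)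
    (hJ : ∀ q : {q // IsUAdmissiblePrime W K q}, GoodLevel W K {q} → JochnowitzAtThree W K Dt β ι q)
    (hV : ∀ q : {q // IsUAdmissiblePrime W K q}, GoodLevel W K {q} → DefiniteUnitValueAtThree W K c q)
    (hd : Nonempty (KolyvaginHeegnerData Dt β ι 1))
    (h1 : finrank (ZMod 3) (AddSubgroup.toZModSubmodule 3 (selmerGroup (W.baseChange K) ((3 ^ 1 : ℕ) : ℤ))) = 1) :
    ∃ d : KolyvaginHeegnerData Dt β ι 1, d.kolyvaginClass Nat.prime_three 1 ≠ 0 := by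
  obtain ⟨d⟩ := hd
  exact ⟨d, kolyvaginClass_one_ne_zero_of_definiteFirstFloor Dt β ι hX hmult hsurj hram htam hK hodd hH hLt h3 hβ hc c hc1 hcc
    hDLR hJ hV h1 d⟩

end Summit.BirchSwinnertonDyer.Rank1Residual.X11b.Three.Koly.Method2DefiniteFirstFloor

end
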